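/-
Copyright (c) 2026. All rights reserved.
Released under Apache 2.0 license as described in the file LICENSE.
-/
import Literature.Probability.FitznerVanDerHofstad2017.SrwIntegralSortedMonotone
import Literature.Probability.FitznerVanDerHofstad2017.SrwIntegralV
import HarnessLib

/-!
# The cell-sup step for the tables `T_{n,l}`, `U_{n,l}` (and `K_{n,l}` on `x ≠ 0`)

[NoBLE17] R. Fitzner, R. van der Hofstad, *Generalized approach to the non-backtracking lace
expansion*, PTRF **169** (2017) 1041–1119, §5.2 p. 1092 and §5.1 p. 1093:

> "(5.11) `T_{n,l}(x) ≤ K_{n,l+1}(x) + (4/d) K_{n,l}(x)`, `T_{n,l}(x) ≤ K_{n,l+1}(x) + (2/d) K_{n+1,l}(x)`;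
> (5.9)/(5.12) `U_{n,l}(x) ≤ [V_{n,2l} L_n(x)]^{1/2}`, `U_{n,l}(x) ≤ K_{n,l}(x)/d`" …
> "we only need to compute `L_n(x)` for a finite number of `n` and `x` … it suffices to consider the
> minimal elements of `Q`, namely `3e₁`, `2e₁+e₂`, `e₁+e₂+e₃`" (p. 1093).

The bounds on `f₃` ([NoBLE17] §3.3.5, (3.58)–(3.86)) read the tables `T`, `U`, `K` as SUPREMA over
symmetric cells of `x ∈ ℤ^d` (`x ≠ 0`, `‖x‖₁ ≥ 2`, `Q = {‖x‖₁ ≥ 3}`), while the notebook `SRW.nb` §2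
evaluates them at finitely many nodes.  The integrands of `T`, `U`, `K` contain `|D̂^{(x)}(k)|` (not its
square), so no monotonicity of `x ↦ T_{n,l}(x)`, `U_{n,l}(x)`, `K_{n,l}(x)` themselves is available; the
cell-sup step goes through the typed MAJORANTS, whose `x`-dependence is through `L_n(x)` and
`W_{n,j}(x)` — and these ARE antitone in the sorted order ([HS92b] Lemma B.4, generalised:
`SrwIntegralSortedMonotone`), with the explicit finite node families

* `x ≠ 0`    : `1^r` (`1 ≤ r ≤ d`);
* `‖x‖₁ ≥ 2` : `2e₁`, `1^r` (`2 ≤ r ≤ d`);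
* `‖x‖₁ ≥ 3` : `3e₁`, `2e₁+e₂`, `2e₁+2e₂`, `1^r` (`3 ≤ r ≤ d`)

(the nodes `2e₁+2e₂` and `1^r`, `r ≥ 4`, are minimal in the sorted order and are NOT removed by
Lemma 5.1 / B.4; they are extra hypotheses relative to the printed three points).

## What is here (all `d`-generic, all proved; nothing is a cited hypothesis)

* `U` (§1): `srwU_le_sqrt_of_le` (monotone form of (5.9)); the cell sups
  `srwU_le_of_onesBounds` (`x ≠ 0`), `srwU_le_of_nodeBounds_two` (`‖x‖₁ ≥ 2`),
  `srwU_le_of_nodeBounds_three` (`‖x‖₁ ≥ 3`) from an upper bound `V_{n,2l} ≤ V'` and node bounds of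
  `L_n`; and `srwU_le_div_of_le` ((5.12) form).
* `K` (§2): `srwK_le_of_onesBounds` — the `x ≠ 0` blanket cell (complementing
  `srwK_le_of_nodeBounds_two/_three` of `SrwIntegralSortedMonotone`).
* `T` (§3): `srwT_le_of_srwK_le_four`, `srwT_le_of_srwK_le_two` (monotone forms of (5.11)) and the
  cell sups `srwT_le_of_onesBounds_four`, `srwT_le_of_nodeBounds_two_four`,
  `srwT_le_of_nodeBounds_three_four` (rule `4/d`, node bounds of `W_{n,j₁}`, `W_{n,j₀}` for any splits
  `l + 1 = m₁ + j₁`, `l = m₀ + j₀`) and `srwT_le_of_nodeBounds_three_two` (rule `2/d`, splits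
  `l + 1 = m₁ + j₁`, `l = m₀ + j₀` at `n` and `n + 1`).

Together with `MeanFieldD11FimSup` (`I`-type cells) and `SrwIntegralSortedMonotone` §5 (`W`, `L`, `K`)
this is the complete lemma-level form of the cell-sup step for the four SRW tables read by the
`f₃` bound; the node VALUES are the business of the certifying table modules (any `d`).

## What is NOT here
No dimension, no table, no numeric value; no statement about `d ≠` anything; the `x = 0` cells are the
exact identities `srwU_zero_even` / `srwK` at `0` and need no sup step.

## References
* [NoBLE17] R. Fitzner, R. van der Hofstad, PTRF 169 (2017) 1041–1119; arXiv:1506.07969 — (5.9), (5.11),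
  (5.12) p. 1091–1092; §5.1 p. 1093 (the cell `Q`); notebook `SRW.nb` §2 (arXiv:1506.07977 anc), cells
  `T[n_,l_,x_]`, `U[n_,l_,x_]`, `K[n_,l_,x_]`.
* [HS92b] T. Hara, G. Slade, Rev. Math. Phys. 4 (1992) 235–327, App. B, Lemma B.4.
-/

namespace Literature.Probability.FitznerVanDerHofstad2017

open Finset Real

variable {d : ℕ}

/-! ### §1  `U_{n,l}` on the cells, through (5.9) `U ≤ √V · √L` -/

/-- Monotone form of (5.9): `V_{n,2l} ≤ V'` and `L_n(x) ≤ B` give `U_{n,l}(x) ≤ √V' · √B`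
(`d ≥ 2n+1`). [cite: FitznerVanDerHofstad2016NoBLE, (5.9) p. 1091] -/
theorem srwU_le_sqrt_of_le {n : ℕ} (hd : 2 * n + 1 ≤ d) (l : ℕ) (x : Fin d → ℤ) {V' B : ℝ}
    (hV : srwV d n (2 * l) ≤ V') (hL : srwL d n x ≤ B) :
    srwU d n l x ≤ Real.sqrt V' * Real.sqrt B :=
  (srwU_le_sqrt_srwV_mul_srwL hd l x).trans
    (mul_le_mul (Real.sqrt_le_sqrt hV) (Real.sqrt_le_sqrt hL) (Real.sqrt_nonneg _)
      (Real.sqrt_nonneg _))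

/-- Monotone form of (5.12): `K_{n,l}(x) ≤ A` gives `U_{n,l}(x) ≤ A / d` (`d ≥ 2n+1`).
[cite: FitznerVanDerHofstad2016NoBLE, (5.12) p. 1092] -/
theorem srwU_le_div_of_le {n : ℕ} (hd : 2 * n + 1 ≤ d) (l : ℕ) (x : Fin d → ℤ) {A : ℝ}
    (hK : srwK d n l x ≤ A) : srwU d n l x ≤ A / d :=
  (srwU_le hd l x).trans (div_le_div_of_nonneg_right hK (Nat.cast_nonneg d))

/-- **`sup_{x ≠ 0} U_{n,l}`**: `U_{n,l}(x) ≤ √V' · √B` for every `x ≠ 0`, from `V_{n,2l} ≤ V'` and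
`L_n(1^r) ≤ B` (`1 ≤ r ≤ d`) (`n ≥ 1`, `d ≥ 2n+1`).
[cite: FitznerVanDerHofstad2016NoBLE, (5.9) p. 1091; HaraSlade1992b, App. B, Lemma B.4] -/
theorem srwU_le_of_onesBounds {n : ℕ} (hn : 1 ≤ n) (hd : 2 * n + 1 ≤ d) (l : ℕ) {V' B : ℝ}
    (hV : srwV d n (2 * l) ≤ V')
    (hB : ∀ r : ℕ, 1 ≤ r → r ≤ d → srwL d n (classVec d r 0) ≤ B)
    (x : Fin d → ℤ) (hx : x ≠ 0) : srwU d n l x ≤ Real.sqrt V' * Real.sqrt B :=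
  srwU_le_sqrt_of_le hd l x hV (srwL_le_of_onesBounds hn hd B hB x hx)

/-- **`sup_{‖x‖₁ ≥ 2} U_{n,l}`**: nodes `2e₁` and `1^r` (`2 ≤ r ≤ d`) for `L_n`.
[cite: FitznerVanDerHofstad2016NoBLE, (5.9) p. 1091, §5.2 p. 1096] -/
theorem srwU_le_of_nodeBounds_two {n : ℕ} (hn : 1 ≤ n) (hd : 2 * n + 1 ≤ d) (l : ℕ) {V' B : ℝ}
    (hV : srwV d n (2 * l) ≤ V') (h2 : srwL d n (vecOfParts d [2]) ≤ B)
    (hB : ∀ r : ℕ, 2 ≤ r → r ≤ d → srwL d n (classVec d r 0) ≤ B)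
    (x : Fin d → ℤ) (hx : 2 ≤ ∑ j, |x j|) : srwU d n l x ≤ Real.sqrt V' * Real.sqrt B :=
  srwU_le_sqrt_of_le hd l x hV (srwL_le_of_nodeBounds_two hn hd B h2 hB x hx)

/-- **`sup_Q U_{n,l}`**, `Q = {‖x‖₁ ≥ 3}`: nodes `3e₁, 2e₁+e₂, 2e₁+2e₂` and `1^r` (`3 ≤ r ≤ d`) for `L_n`.
[cite: FitznerVanDerHofstad2016NoBLE, (5.9) p. 1091, §5.1 p. 1093] -/
theorem srwU_le_of_nodeBounds_three {n : ℕ} (hn : 1 ≤ n) (hd : 2 * n + 1 ≤ d) (l : ℕ) {V' B : ℝ}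
    (hV : srwV d n (2 * l) ≤ V') (h3 : srwL d n (vecOfParts d [3]) ≤ B)
    (h21 : srwL d n (vecOfParts d [2, 1]) ≤ B) (h22 : srwL d n (vecOfParts d [2, 2]) ≤ B)
    (hB : ∀ r : ℕ, 3 ≤ r → r ≤ d → srwL d n (classVec d r 0) ≤ B)
    (x : Fin d → ℤ) (hx : 3 ≤ ∑ j, |x j|) : srwU d n l x ≤ Real.sqrt V' * Real.sqrt B :=
  srwU_le_sqrt_of_le hd l x hV (srwL_le_of_nodeBounds_three hn hd B h3 h21 h22 hB x hx)

/-! ### §2  `K_{n,m+j}` on `x ≠ 0` (the blanket cell) -/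

/-- **`sup_{x ≠ 0} K_{n,m+j} ≤ √I_{n,2m}(0) · √B`** from `W_{n,j}(1^r) ≤ B` (`1 ≤ r ≤ d`)
(`n ≥ 1`, `d ≥ 2n+1`). [cite: FitznerVanDerHofstad2016NoBLE, (5.28)–(5.29) p. 1093; HaraSlade1992b, App. B, Lemma B.4] -/
theorem srwK_le_of_onesBounds {n : ℕ} (hn : 1 ≤ n) (hd : 2 * n + 1 ≤ d) (m j : ℕ) (B : ℝ)
    (hB : ∀ r : ℕ, 1 ≤ r → r ≤ d → srwW d n j (classVec d r 0) ≤ B)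
    (x : Fin d → ℤ) (hx : x ≠ 0) :
    srwK d n (m + j) x ≤ Real.sqrt (srwI d n (2 * m) 0) * Real.sqrt B :=
  srwK_le_sqrt_of_srwW_le hd m j x (srwW_le_of_onesBounds hn hd j B hB x hx)

/-! ### §3  `T_{n,l}` on the cells, through (5.11) -/

/-- Monotone form of (5.11), first rule: `K_{n,l+1}(x) ≤ A₁`, `K_{n,l}(x) ≤ A₀` give
`T_{n,l}(x) ≤ A₁ + (4/d) A₀` (`d ≥ 2n+1`). [cite: FitznerVanDerHofstad2016NoBLE, (5.11) p. 1092] -/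
theorem srwT_le_of_srwK_le_four {n : ℕ} (hd : 2 * n + 1 ≤ d) (l : ℕ) (x : Fin d → ℤ) {A₁ A₀ : ℝ}
    (h1 : srwK d n (l + 1) x ≤ A₁) (h0 : srwK d n l x ≤ A₀) :
    srwT d n l x ≤ A₁ + 4 / d * A₀ :=
  (srwT_le_four hd l x).trans (add_le_add h1 (mul_le_mul_of_nonneg_left h0 (by positivity)))

/-- Monotone form of (5.11), second rule: `K_{n,l+1}(x) ≤ A₁`, `K_{n+1,l}(x) ≤ A₀` give
`T_{n,l}(x) ≤ A₁ + (2/d) A₀` (`d ≥ 2(n+1)+1`). [cite: FitznerVanDerHofstad2016NoBLE, (5.11) p. 1092] -/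
theorem srwT_le_of_srwK_le_two {n : ℕ} (hd : 2 * (n + 1) + 1 ≤ d) (l : ℕ) (x : Fin d → ℤ)
    {A₁ A₀ : ℝ} (h1 : srwK d n (l + 1) x ≤ A₁) (h0 : srwK d (n + 1) l x ≤ A₀) :
    srwT d n l x ≤ A₁ + 2 / d * A₀ :=
  (srwT_le_two hd l x).trans (add_le_add h1 (mul_le_mul_of_nonneg_left h0 (by positivity)))

/-- **`sup_{x ≠ 0} T_{n,l}`** (rule `4/d`): for splits `l + 1 = m₁ + j₁`, `l = m₀ + j₀` and node bounds
`W_{n,j₁}(1^r) ≤ B₁`, `W_{n,j₀}(1^r) ≤ B₀` (`1 ≤ r ≤ d`):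
`T_{n,l}(x) ≤ √I_{n,2m₁}(0) √B₁ + (4/d) √I_{n,2m₀}(0) √B₀` for every `x ≠ 0` (`n ≥ 1`, `d ≥ 2n+1`).
[cite: FitznerVanDerHofstad2016NoBLE, (5.11) p. 1092, (5.28)–(5.29) p. 1093] -/
theorem srwT_le_of_onesBounds_four {n : ℕ} (hn : 1 ≤ n) (hd : 2 * n + 1 ≤ d) {l m₁ j₁ m₀ j₀ : ℕ}
    (hl1 : m₁ + j₁ = l + 1) (hl0 : m₀ + j₀ = l) (B₁ B₀ : ℝ)
    (hB1 : ∀ r : ℕ, 1 ≤ r → r ≤ d → srwW d n j₁ (classVec d r 0) ≤ B₁)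
    (hB0 : ∀ r : ℕ, 1 ≤ r → r ≤ d → srwW d n j₀ (classVec d r 0) ≤ B₀)
    (x : Fin d → ℤ) (hx : x ≠ 0) :
    srwT d n l x ≤ Real.sqrt (srwI d n (2 * m₁) 0) * Real.sqrt B₁ +
      4 / d * (Real.sqrt (srwI d n (2 * m₀) 0) * Real.sqrt B₀) := by
  have h1 := srwK_le_of_onesBounds hn hd m₁ j₁ B₁ hB1 x hx
  have h0 := srwK_le_of_onesBounds hn hd m₀ j₀ B₀ hB0 x hx
  rw [hl1] at h1
  rw [hl0] at h0
  exact srwT_le_of_srwK_le_four hd l x h1 h0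

/-- **`sup_{‖x‖₁ ≥ 2} T_{n,l}`** (rule `4/d`): nodes `2e₁`, `1^r` (`2 ≤ r ≤ d`) for `W_{n,j₁}` and
`W_{n,j₀}`, splits `l + 1 = m₁ + j₁`, `l = m₀ + j₀`.
[cite: FitznerVanDerHofstad2016NoBLE, (5.11) p. 1092, §5.2 p. 1096] -/
theorem srwT_le_of_nodeBounds_two_four {n : ℕ} (hn : 1 ≤ n) (hd : 2 * n + 1 ≤ d)
    {l m₁ j₁ m₀ j₀ : ℕ} (hl1 : m₁ + j₁ = l + 1) (hl0 : m₀ + j₀ = l) (B₁ B₀ : ℝ)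
    (h2₁ : srwW d n j₁ (vecOfParts d [2]) ≤ B₁)
    (hB1 : ∀ r : ℕ, 2 ≤ r → r ≤ d → srwW d n j₁ (classVec d r 0) ≤ B₁)
    (h2₀ : srwW d n j₀ (vecOfParts d [2]) ≤ B₀)
    (hB0 : ∀ r : ℕ, 2 ≤ r → r ≤ d → srwW d n j₀ (classVec d r 0) ≤ B₀)
    (x : Fin d → ℤ) (hx : 2 ≤ ∑ j, |x j|) :
    srwT d n l x ≤ Real.sqrt (srwI d n (2 * m₁) 0) * Real.sqrt B₁ +
      4 / d * (Real.sqrt (srwI d n (2 * m₀) 0) * Real.sqrt B₀) := by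
  have h1 := srwK_le_of_nodeBounds_two hn hd m₁ j₁ B₁ h2₁ hB1 x hx
  have h0 := srwK_le_of_nodeBounds_two hn hd m₀ j₀ B₀ h2₀ hB0 x hx
  rw [hl1] at h1
  rw [hl0] at h0
  exact srwT_le_of_srwK_le_four hd l x h1 h0

/-- **`sup_Q T_{n,l}`** (rule `4/d`), `Q = {‖x‖₁ ≥ 3}`: nodes `3e₁, 2e₁+e₂, 2e₁+2e₂, 1^r (3 ≤ r ≤ d)`
for `W_{n,j₁}` and `W_{n,j₀}`, splits `l + 1 = m₁ + j₁`, `l = m₀ + j₀`.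
[cite: FitznerVanDerHofstad2016NoBLE, (5.11) p. 1092, §5.1 p. 1093] -/
theorem srwT_le_of_nodeBounds_three_four {n : ℕ} (hn : 1 ≤ n) (hd : 2 * n + 1 ≤ d)
    {l m₁ j₁ m₀ j₀ : ℕ} (hl1 : m₁ + j₁ = l + 1) (hl0 : m₀ + j₀ = l) (B₁ B₀ : ℝ)
    (h3₁ : srwW d n j₁ (vecOfParts d [3]) ≤ B₁) (h21₁ : srwW d n j₁ (vecOfParts d [2, 1]) ≤ B₁)
    (h22₁ : srwW d n j₁ (vecOfParts d [2, 2]) ≤ B₁)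
    (hB1 : ∀ r : ℕ, 3 ≤ r → r ≤ d → srwW d n j₁ (classVec d r 0) ≤ B₁)
    (h3₀ : srwW d n j₀ (vecOfParts d [3]) ≤ B₀) (h21₀ : srwW d n j₀ (vecOfParts d [2, 1]) ≤ B₀)
    (h22₀ : srwW d n j₀ (vecOfParts d [2, 2]) ≤ B₀)
    (hB0 : ∀ r : ℕ, 3 ≤ r → r ≤ d → srwW d n j₀ (classVec d r 0) ≤ B₀)
    (x : Fin d → ℤ) (hx : 3 ≤ ∑ j, |x j|) :
    srwT d n l x ≤ Real.sqrt (srwI d n (2 * m₁) 0) * Real.sqrt B₁ +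
      4 / d * (Real.sqrt (srwI d n (2 * m₀) 0) * Real.sqrt B₀) := by
  have h1 := srwK_le_of_nodeBounds_three hn hd m₁ j₁ B₁ h3₁ h21₁ h22₁ hB1 x hx
  have h0 := srwK_le_of_nodeBounds_three hn hd m₀ j₀ B₀ h3₀ h21₀ h22₀ hB0 x hx
  rw [hl1] at h1
  rw [hl0] at h0
  exact srwT_le_of_srwK_le_four hd l x h1 h0

/-- **`sup_Q T_{n,l}`** (rule `2/d`), `Q = {‖x‖₁ ≥ 3}`: node bounds for `W_{n,j₁}` (`l + 1 = m₁ + j₁`,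
at `n`) and `W_{n+1,j₀}` (`l = m₀ + j₀`, at `n + 1`), `d ≥ 2(n+1)+1`, `n ≥ 1`:
`T_{n,l}(x) ≤ √I_{n,2m₁}(0) √B₁ + (2/d) √I_{n+1,2m₀}(0) √B₀`.
[cite: FitznerVanDerHofstad2016NoBLE, (5.11) p. 1092, §5.1 p. 1093] -/
theorem srwT_le_of_nodeBounds_three_two {n : ℕ} (hn : 1 ≤ n) (hd : 2 * (n + 1) + 1 ≤ d)
    {l m₁ j₁ m₀ j₀ : ℕ} (hl1 : m₁ + j₁ = l + 1) (hl0 : m₀ + j₀ = l) (B₁ B₀ : ℝ)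
    (h3₁ : srwW d n j₁ (vecOfParts d [3]) ≤ B₁) (h21₁ : srwW d n j₁ (vecOfParts d [2, 1]) ≤ B₁)
    (h22₁ : srwW d n j₁ (vecOfParts d [2, 2]) ≤ B₁)
    (hB1 : ∀ r : ℕ, 3 ≤ r → r ≤ d → srwW d n j₁ (classVec d r 0) ≤ B₁)
    (h3₀ : srwW d (n + 1) j₀ (vecOfParts d [3]) ≤ B₀)
    (h21₀ : srwW d (n + 1) j₀ (vecOfParts d [2, 1]) ≤ B₀)
    (h22₀ : srwW d (n + 1) j₀ (vecOfParts d [2, 2]) ≤ B₀)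
    (hB0 : ∀ r : ℕ, 3 ≤ r → r ≤ d → srwW d (n + 1) j₀ (classVec d r 0) ≤ B₀)
    (x : Fin d → ℤ) (hx : 3 ≤ ∑ j, |x j|) :
    srwT d n l x ≤ Real.sqrt (srwI d n (2 * m₁) 0) * Real.sqrt B₁ +
      2 / d * (Real.sqrt (srwI d (n + 1) (2 * m₀) 0) * Real.sqrt B₀) := by
  have hd' : 2 * n + 1 ≤ d := by omega
  have h1 := srwK_le_of_nodeBounds_three hn hd' m₁ j₁ B₁ h3₁ h21₁ h22₁ hB1 x hx
  have h0 := srwK_le_of_nodeBounds_three (by omega) hd m₀ j₀ B₀ h3₀ h21₀ h22₀ hB0 x hx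
  rw [hl1] at h1
  rw [hl0] at h0
  exact srwT_le_of_srwK_le_two hd l x h1 h0

end Literature.Probability.FitznerVanDerHofstad2017
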